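import Summits.AtomisticToContinuum.BoseEinsteinCondensation.Theorems.BECCutLineWeakDisorderGroundStateRigidityStubCompactness
import Mathlib.Analysis.FunctionalSpaces.SobolevInequality
import Mathlib.Analysis.InnerProductSpace.Calculus
import Mathlib.Analysis.SpecialFunctions.Sqrt
import Mathlib.Analysis.SpecialFunctions.Pow.Asymptotics
import HarnessLib

/-!
# Crux `GroundStateRigidity` (stmt-AtomisticToContinuum-9072), line `Sketch`:
# the registered stub `stub_truncHigh`

Supports (does not close) stmt-AtomisticToContinuum-9072; stub `stub_truncHigh` of line `Sketch`
(lead c2). **Amplitude truncation of trial states at no kinetic cost and small `L²` error,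
uniformly over trial states of bounded kinetic energy** (Gagliardo–Nirenberg–Sobolev).

## Proof

* `T_M z = (M / √(M² + |z|²)) • z` (written out, no auxiliary definition) is a smooth radial
  contraction of `ℂ` into the disc of radius `M`; `|T_M z| ≤ min(|z|, M)`, `T_M 0 = 0`, and `T_M`
  is `1`-Lipschitz (`norm_trunc_sub_trunc_le`, an explicit sum-of-squares identity), hence
  `‖DT_M(z)‖ ≤ 1` (`norm_fderiv_le_of_lipschitz`), so `g = T_M ∘ Ψ` has every partial derivative
  bounded by that of `Ψ` (chain rule): no kinetic cost, and `g` inherits `C¹`, the Dirichlet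
  condition and symmetry.
* Pointwise `|T_M z − z|² ≤ M^{2−p} |z|^p` for `2 ≤ p ≤ 6` (`|T_M z − z| ≤ min(|z|, |z|³/M²)`).
* With `p = 6N/(3N−2)`, `p⁻¹ = 2⁻¹ − (3N)⁻¹`, Mathlib's GNS inequality
  `MeasureTheory.eLpNorm_le_eLpNorm_fderiv_of_eq` on `(ℝ³)^N` and the tree's
  `eLpNorm_fderiv_le` (`‖DΨ‖₂ ≤ (3N ∫|∇Ψ|²)^{1/2}`) give `∫|Ψ|^p ≤ S(N, K) < ∞` whenever
  `∫|∇Ψ|² ≤ K`, independently of the box; so `∫|g − Ψ|² ≤ M^{2−p} S ≤ η` for `M = B` large.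
-/

noncomputable section

open MeasureTheory Filter Module
open scoped ENNReal NNReal Topology InnerProductSpace

namespace Summit.AtomisticToContinuum.BoseEinsteinCondensation.Theorems.GroundStateRigidity

open Literature.MathematicalPhysics.QuantumManyBody.BoseGas

namespace TruncHigh

/-! ### The smooth non-expansive radial truncation `T_M z = (M / √(M² + |z|²)) • z` of `ℂ`

No auxiliary definitions are introduced: the map is written out as
`fun z : ℂ => (M / √(M ^ 2 + ‖z‖ ^ 2)) • z` (real scalar multiplication on `ℂ`). -/

variable {M : ℝ}

/-- `√(M² + |z|²) > 0`. [folklore] -/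
theorem sqrt_pos (hM : 0 < M) (z : ℂ) : 0 < √(M ^ 2 + ‖z‖ ^ 2) :=
  Real.sqrt_pos.2 (by positivity)

/-- `M ≤ √(M² + |z|²)`. [folklore] -/
theorem le_sqrt (hM : 0 < M) (z : ℂ) : M ≤ √(M ^ 2 + ‖z‖ ^ 2) := by
  rw [Real.le_sqrt hM.le (by positivity)]
  nlinarith [sq_nonneg ‖z‖]

/-- `|z| ≤ √(M² + |z|²)`. [folklore] -/
theorem norm_le_sqrt (M : ℝ) (z : ℂ) : ‖z‖ ≤ √(M ^ 2 + ‖z‖ ^ 2) := by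
  rw [Real.le_sqrt (norm_nonneg _) (by positivity)]
  nlinarith [sq_nonneg M]

/-- `(√(M² + |z|²))² = M² + |z|²`. [folklore] -/
theorem sq_sqrt (M : ℝ) (z : ℂ) : √(M ^ 2 + ‖z‖ ^ 2) ^ 2 = M ^ 2 + ‖z‖ ^ 2 :=
  Real.sq_sqrt (by positivity)

/-- The scalar factor `M / √(M² + |z|²)` is positive. [folklore] -/
theorem fac_pos (hM : 0 < M) (z : ℂ) : 0 < M / √(M ^ 2 + ‖z‖ ^ 2) := div_pos hM (sqrt_pos hM z)

/-- The scalar factor is at most `1`. [folklore] -/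
theorem fac_le_one (hM : 0 < M) (z : ℂ) : M / √(M ^ 2 + ‖z‖ ^ 2) ≤ 1 :=
  (div_le_one (sqrt_pos hM z)).2 (le_sqrt hM z)

/-- `|T_M z| = fac · |z|`. [folklore] -/
theorem norm_trunc (hM : 0 < M) (z : ℂ) :
    ‖(M / √(M ^ 2 + ‖z‖ ^ 2)) • z‖ = M / √(M ^ 2 + ‖z‖ ^ 2) * ‖z‖ := by
  rw [norm_smul, Real.norm_eq_abs, abs_of_pos (fac_pos hM z)]

/-- `|T_M z| ≤ |z|`. [folklore] -/
theorem norm_trunc_le_norm (hM : 0 < M) (z : ℂ) : ‖(M / √(M ^ 2 + ‖z‖ ^ 2)) • z‖ ≤ ‖z‖ := by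
  rw [norm_trunc hM]
  exact mul_le_of_le_one_left (norm_nonneg _) (fac_le_one hM z)

/-- `|T_M z| ≤ M`. [folklore] -/
theorem norm_trunc_le (hM : 0 < M) (z : ℂ) : ‖(M / √(M ^ 2 + ‖z‖ ^ 2)) • z‖ ≤ M := by
  rw [norm_trunc hM, div_mul_eq_mul_div, div_le_iff₀ (sqrt_pos hM z)]
  exact mul_le_mul_of_nonneg_left (norm_le_sqrt M z) hM.le

/-- `T_M` is smooth (`M > 0`). [folklore] -/
theorem contDiff_trunc (hM : 0 < M) {n : WithTop ℕ∞} :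
    ContDiff ℝ n fun z : ℂ => (M / √(M ^ 2 + ‖z‖ ^ 2)) • z := by
  have h1 : ContDiff ℝ n fun z : ℂ => M ^ 2 + ‖z‖ ^ 2 := contDiff_const.add (contDiff_norm_sq ℝ)
  have h2 : ContDiff ℝ n fun z : ℂ => √(M ^ 2 + ‖z‖ ^ 2) :=
    h1.sqrt fun z => (lt_of_lt_of_le (by positivity) le_rfl : (0 : ℝ) < M ^ 2 + ‖z‖ ^ 2).ne'
  exact (contDiff_const.div h2 fun z => (sqrt_pos hM z).ne').smul contDiff_id

/-- **`T_M` is `1`-Lipschitz**: with `A = √(M²+|z|²)`, `B = √(M²+|w|²)`, `c = ⟪z,w⟫ + M² ≤ AB`,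
`|z-w|² - |T z - T w|² = (A-B)² + M²(M/A - M/B)² + 2(AB - c)(1 - M²/(AB)) ≥ 0` (this is the
non-expansiveness of the radial retraction of `ℝ³ ⊇ ℂ × {M}` onto the sphere of radius `M`).
[folklore] -/
theorem norm_trunc_sub_trunc_le (hM : 0 < M) (z w : ℂ) :
    ‖(M / √(M ^ 2 + ‖z‖ ^ 2)) • z - (M / √(M ^ 2 + ‖w‖ ^ 2)) • w‖ ≤ ‖z - w‖ := by
  refine le_of_pow_le_pow_left₀ two_ne_zero (norm_nonneg _) ?_
  set A := √(M ^ 2 + ‖z‖ ^ 2) with hA_def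
  set B := √(M ^ 2 + ‖w‖ ^ 2) with hB_def
  have hA : A ^ 2 = M ^ 2 + ‖z‖ ^ 2 := sq_sqrt M z
  have hB : B ^ 2 = M ^ 2 + ‖w‖ ^ 2 := sq_sqrt M w
  have hMA : M ≤ A := le_sqrt hM z
  have hMB : M ≤ B := le_sqrt hM w
  have hApos : 0 < A := hM.trans_le hMA
  have hBpos : 0 < B := hM.trans_le hMB
  have hρ : ⟪z, w⟫_ℝ ≤ ‖z‖ * ‖w‖ := real_inner_le_norm z w
  set a := M / A with ha_def
  set b := M / B with hb_def
  have ha : 0 < a := div_pos hM hApos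
  have hb : 0 < b := div_pos hM hBpos
  have haA : a * A = M := div_mul_cancel₀ M hApos.ne'
  have hbB : b * B = M := div_mul_cancel₀ M hBpos.ne'
  have ha1 : a ≤ 1 := (div_le_one hApos).2 hMA
  have hb1 : b ≤ 1 := (div_le_one hBpos).2 hMB
  have hexp : ‖a • z - b • w‖ ^ 2 =
      a ^ 2 * ‖z‖ ^ 2 - 2 * (a * b * ⟪z, w⟫_ℝ) + b ^ 2 * ‖w‖ ^ 2 := by
    rw [norm_sub_sq_real, norm_smul, norm_smul, real_inner_smul_left, real_inner_smul_right,
      Real.norm_eq_abs, Real.norm_eq_abs, abs_of_pos ha, abs_of_pos hb]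
    ring
  rw [hexp, norm_sub_sq_real]
  -- key: `|z||w| + M² ≤ A B`
  have hkey : ‖z‖ * ‖w‖ + M ^ 2 ≤ A * B := by
    refine le_of_pow_le_pow_left₀ two_ne_zero (by positivity) ?_
    rw [mul_pow, hA, hB]
    nlinarith [sq_nonneg (M * (‖z‖ - ‖w‖)), norm_nonneg z, norm_nonneg w]
  have hc : ⟪z, w⟫_ℝ + M ^ 2 ≤ A * B := by linarith
  have hab1 : a * b ≤ 1 := mul_le_one₀ ha1 hb.le hb1
  have habAB : a * b * (A * B) = M ^ 2 := by
    calc a * b * (A * B) = (a * A) * (b * B) := by ring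
      _ = M ^ 2 := by rw [haA, hbB, sq]
  have hx2 : a ^ 2 * ‖z‖ ^ 2 = M ^ 2 - a ^ 2 * M ^ 2 := by
    have h1 : a ^ 2 * A ^ 2 = M ^ 2 := by rw [← mul_pow, haA]
    have h2 : ‖z‖ ^ 2 = A ^ 2 - M ^ 2 := by linarith [hA]
    rw [h2, mul_sub, h1]
  have hy2 : b ^ 2 * ‖w‖ ^ 2 = M ^ 2 - b ^ 2 * M ^ 2 := by
    have h1 : b ^ 2 * B ^ 2 = M ^ 2 := by rw [← mul_pow, hbB]
    have h2 : ‖w‖ ^ 2 = B ^ 2 - M ^ 2 := by linarith [hB]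
    rw [h2, mul_sub, h1]
  nlinarith [mul_nonneg (sub_nonneg.2 hc) (sub_nonneg.2 hab1), sq_nonneg (a - b), sq_nonneg (A - B),
    hx2, hy2, habAB, hA, hB]

/-- `T_M` is `1`-Lipschitz. [folklore] -/
theorem lipschitzWith_trunc (hM : 0 < M) :
    LipschitzWith 1 fun z : ℂ => (M / √(M ^ 2 + ‖z‖ ^ 2)) • z :=
  LipschitzWith.of_dist_le_mul fun z w => by
    simpa only [NNReal.coe_one, one_mul, dist_eq_norm] using norm_trunc_sub_trunc_le hM z w

/-- **Non-expansive derivative**: `|DT_M(z) w| ≤ |w|`. [folklore] -/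
theorem norm_fderiv_trunc_apply_le (hM : 0 < M) (z w : ℂ) :
    ‖fderiv ℝ (fun z : ℂ => (M / √(M ^ 2 + ‖z‖ ^ 2)) • z) z w‖ ≤ ‖w‖ := by
  have h : ‖fderiv ℝ (fun z : ℂ => (M / √(M ^ 2 + ‖z‖ ^ 2)) • z) z‖ ≤ 1 := by
    simpa using norm_fderiv_le_of_lipschitz ℝ (x₀ := z) (lipschitzWith_trunc hM)
  exact ((fderiv ℝ _ z).le_opNorm w).trans (mul_le_of_le_one_left (norm_nonneg w) h)

/-- `|T_M z - z| = (1 - fac) |z|`. [folklore] -/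
theorem norm_trunc_sub_eq (hM : 0 < M) (z : ℂ) :
    ‖(M / √(M ^ 2 + ‖z‖ ^ 2)) • z - z‖ = (1 - M / √(M ^ 2 + ‖z‖ ^ 2)) * ‖z‖ := by
  have h : (M / √(M ^ 2 + ‖z‖ ^ 2)) • z - z = (M / √(M ^ 2 + ‖z‖ ^ 2) - 1) • z := by
    rw [sub_smul, one_smul]
  rw [h, norm_smul, Real.norm_eq_abs, abs_sub_comm,
    abs_of_nonneg (sub_nonneg.2 (fac_le_one hM z))]

/-- `|T_M z - z| ≤ |z|`. [folklore] -/
theorem norm_trunc_sub_le (hM : 0 < M) (z : ℂ) : ‖(M / √(M ^ 2 + ‖z‖ ^ 2)) • z - z‖ ≤ ‖z‖ := by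
  rw [norm_trunc_sub_eq hM]
  exact mul_le_of_le_one_left (norm_nonneg _) (sub_le_self _ (fac_pos hM z).le)

/-- `|T_M z - z| ≤ |z|³ / M²` (`1 - fac ≤ 1 - fac² = |z|²/(M²+|z|²) ≤ |z|²/M²`). [folklore] -/
theorem norm_trunc_sub_le' (hM : 0 < M) (z : ℂ) :
    ‖(M / √(M ^ 2 + ‖z‖ ^ 2)) • z - z‖ ≤ ‖z‖ ^ 3 / M ^ 2 := by
  rw [norm_trunc_sub_eq hM]
  have hf := fac_pos hM z
  have hf1 := fac_le_one hM z
  have h1 : 1 - M / √(M ^ 2 + ‖z‖ ^ 2) ≤ 1 - (M / √(M ^ 2 + ‖z‖ ^ 2)) ^ 2 := by nlinarith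
  have h2 : 1 - (M / √(M ^ 2 + ‖z‖ ^ 2)) ^ 2 ≤ ‖z‖ ^ 2 / M ^ 2 := by
    have hA := sq_sqrt M z
    have hMA := le_sqrt hM z
    have hApos := sqrt_pos hM z
    rw [div_pow, hA, sub_le_iff_le_add, div_add_div _ _ (by positivity) (by positivity),
      le_div_iff₀ (by positivity)]
    nlinarith [sq_nonneg ‖z‖, sq_nonneg (‖z‖ ^ 2), mul_pos hM hM]
  calc (1 - M / √(M ^ 2 + ‖z‖ ^ 2)) * ‖z‖ ≤ ‖z‖ ^ 2 / M ^ 2 * ‖z‖ :=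
        mul_le_mul_of_nonneg_right (h1.trans h2) (norm_nonneg _)
    _ = ‖z‖ ^ 3 / M ^ 2 := by ring

/-- **Small `L²` error pointwise**: `|T_M z - z|² ≤ M^{2-p} |z|^p` for `2 ≤ p ≤ 6` (case `|z| ≤ M`:
`|T z - z|² ≤ |z|⁶/M⁴ ≤ M^{2-p}|z|^p`; case `|z| > M`: `|T z - z|² ≤ |z|² ≤ M^{2-p} |z|^p`).
[folklore] -/
theorem norm_trunc_sub_sq_le (hM : 0 < M) {p : ℝ} (hp2 : 2 ≤ p) (hp6 : p ≤ 6) (z : ℂ) :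
    ‖(M / √(M ^ 2 + ‖z‖ ^ 2)) • z - z‖ ^ 2 ≤ M ^ (2 - p) * ‖z‖ ^ p := by
  have hx := norm_nonneg z
  rcases le_or_gt ‖z‖ M with hzM | hzM
  · -- `|z| ≤ M`
    have h1 : ‖(M / √(M ^ 2 + ‖z‖ ^ 2)) • z - z‖ ^ 2 ≤ (‖z‖ ^ 3 / M ^ 2) ^ 2 :=
      pow_le_pow_left₀ (norm_nonneg _) (norm_trunc_sub_le' hM z) 2
    refine h1.trans ?_
    have h6 : ‖z‖ ^ (6 : ℝ) = ‖z‖ ^ p * ‖z‖ ^ (6 - p) := by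
      rw [← Real.rpow_add_of_nonneg hx (by linarith) (by linarith)]
      ring_nf
    have h3 : ‖z‖ ^ (6 - p) ≤ M ^ (6 - p) := Real.rpow_le_rpow hx hzM (by linarith)
    have h4 : M ^ (6 - p) = M ^ (2 - p) * M ^ 4 := by
      rw [show (6 - p : ℝ) = (2 - p) + 4 by ring, Real.rpow_add hM, show (4 : ℝ) = (4 : ℕ) by
        norm_num, Real.rpow_natCast]
    calc (‖z‖ ^ 3 / M ^ 2) ^ 2 = ‖z‖ ^ (6 : ℝ) / M ^ 4 := by
          rw [show (6 : ℝ) = (6 : ℕ) by norm_num, Real.rpow_natCast]; ring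
      _ = ‖z‖ ^ p * ‖z‖ ^ (6 - p) / M ^ 4 := by rw [h6]
      _ ≤ ‖z‖ ^ p * M ^ (6 - p) / M ^ 4 := by gcongr
      _ = M ^ (2 - p) * ‖z‖ ^ p := by rw [h4]; field_simp
  · -- `|z| > M`
    have h1 : ‖(M / √(M ^ 2 + ‖z‖ ^ 2)) • z - z‖ ^ 2 ≤ ‖z‖ ^ 2 :=
      pow_le_pow_left₀ (norm_nonneg _) (norm_trunc_sub_le hM z) 2
    refine h1.trans ?_
    have hz0 : 0 < ‖z‖ := hM.trans hzM
    have h2 : ‖z‖ ^ (2 : ℝ) = ‖z‖ ^ (2 - p) * ‖z‖ ^ p := by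
      rw [← Real.rpow_add hz0]; ring_nf
    have h3 : ‖z‖ ^ (2 - p) ≤ M ^ (2 - p) := Real.rpow_le_rpow_of_nonpos hM hzM.le (by linarith)
    calc ‖z‖ ^ 2 = ‖z‖ ^ (2 : ℝ) := (Real.rpow_two _).symm
      _ = ‖z‖ ^ (2 - p) * ‖z‖ ^ p := h2
      _ ≤ M ^ (2 - p) * ‖z‖ ^ p := by gcongr

/-- The pointwise error bound in `ℝ≥0∞`. [folklore] -/
theorem enorm_trunc_sub_sq_le (hM : 0 < M) {p : ℝ} (hp2 : 2 ≤ p) (hp6 : p ≤ 6) (z : ℂ) :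
    ((‖(M / √(M ^ 2 + ‖z‖ ^ 2)) • z - z‖₊ : ℝ≥0∞)) ^ 2 ≤
      ENNReal.ofReal (M ^ (2 - p)) * ‖z‖ₑ ^ p := by
  calc ((‖(M / √(M ^ 2 + ‖z‖ ^ 2)) • z - z‖₊ : ℝ≥0∞)) ^ 2
      = ENNReal.ofReal (‖(M / √(M ^ 2 + ‖z‖ ^ 2)) • z - z‖ ^ 2) := by
        rw [ENNReal.ofReal_pow (norm_nonneg _), ofReal_norm, enorm_eq_nnnorm]
    _ ≤ ENNReal.ofReal (M ^ (2 - p) * ‖z‖ ^ p) :=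
        ENNReal.ofReal_le_ofReal (norm_trunc_sub_sq_le hM hp2 hp6 z)
    _ = ENNReal.ofReal (M ^ (2 - p)) * ‖z‖ₑ ^ p := by
        rw [ENNReal.ofReal_mul (by positivity), ← ofReal_norm,
          ENNReal.ofReal_rpow_of_nonneg (norm_nonneg _) (by linarith)]

/-! ### Composition with a `C¹` map on configuration space -/

variable {N : ℕ}

/-- Chain rule and non-expansiveness: each partial derivative of `T_M ∘ ψ` is bounded by the
corresponding one of `ψ`. [folklore] -/
theorem norm_fderiv_comp_apply_le (hM : 0 < M) {ψ : Config N → ℂ} (hψ : ContDiff ℝ 1 ψ)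
    (X e : Config N) :
    ‖fderiv ℝ (fun Y => (M / √(M ^ 2 + ‖ψ Y‖ ^ 2)) • ψ Y) X e‖ ≤ ‖fderiv ℝ ψ X e‖ := by
  have hd : DifferentiableAt ℝ (fun z : ℂ => (M / √(M ^ 2 + ‖z‖ ^ 2)) • z) (ψ X) :=
    ((contDiff_trunc hM (n := 1)).differentiable one_ne_zero) _
  have h : fderiv ℝ (fun Y => (M / √(M ^ 2 + ‖ψ Y‖ ^ 2)) • ψ Y) X =
      (fderiv ℝ (fun z : ℂ => (M / √(M ^ 2 + ‖z‖ ^ 2)) • z) (ψ X)).comp (fderiv ℝ ψ X) :=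
    (hd.hasFDerivAt.comp X (hψ.differentiable one_ne_zero X).hasFDerivAt).fderiv
  rw [h, ContinuousLinearMap.comp_apply]
  exact norm_fderiv_trunc_apply_le hM _ _

/-- No kinetic cost: `|∇(T_M ∘ ψ)|² ≤ |∇ψ|²` pointwise. [folklore] -/
theorem kineticDensity_comp_le (hM : 0 < M) {ψ : Config N → ℂ} (hψ : ContDiff ℝ 1 ψ)
    (X : Config N) :
    kineticDensity (fun Y => (M / √(M ^ 2 + ‖ψ Y‖ ^ 2)) • ψ Y) X ≤ kineticDensity ψ X := by
  unfold kineticDensity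
  refine Finset.sum_le_sum fun i _ => Finset.sum_le_sum fun k _ => ?_
  have h := norm_fderiv_comp_apply_le hM hψ X (Pi.single i (EuclideanSpace.single k (1 : ℝ)))
  gcongr
  exact h

/-! ### Sobolev bookkeeping on `(ℝ³)^N` -/

/-- `dim (ℝ³)^N = 3N`. [folklore] -/
theorem finrank_config (N : ℕ) : finrank ℝ (Config N) = 3 * N := by
  rw [Module.finrank_pi_fintype ℝ]
  simp only [finrank_euclideanSpace_fin, Finset.sum_const, Finset.card_univ, Fintype.card_fin,
    smul_eq_mul]
  ring

/-- Trial states have compact support (the closed box). [folklore] -/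
theorem hasCompactSupport_psi {L : ℝ} (Ψ : TrialState N L) : HasCompactSupport Ψ.ψ :=
  HasCompactSupport.intro' (isBounded_boxN N L).isCompact_closure isClosed_closure
    fun x hx => Ψ.eq_zero x fun h => hx (subset_closure h)

/-- `energy 0 Ψ = ∫ |∇Ψ|²`. [folklore] -/
theorem energy_zero_eq {L : ℝ} (Ψ : TrialState N L) :
    energy 0 Ψ = ∫⁻ X, kineticDensity Ψ.ψ X := by
  simp [energy, interaction]

end TruncHigh

open TruncHigh

/-- **Stub `stub_truncHigh` of line `Sketch` — amplitude truncation of trial states at no kinetic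
cost (Gagliardo–Nirenberg–Sobolev).** For `N ≥ 1`, a kinetic bound `K` and `η > 0` there is `B`
such that every trial state `Ψ` (any box) with `∫|∇Ψ|² ≤ K` admits a `C¹`, Dirichlet, symmetric
`g` with `|g| ≤ B`, `|g| ≤ |Ψ|`, `|∇g|² ≤ |∇Ψ|²` pointwise and `∫|g − Ψ|² ≤ η`: `g = T_M ∘ Ψ` with
the smooth `1`-Lipschitz radial map `T_M(z) = (M / √(M² + |z|²)) z` (`|DT_M(z) w| ≤ |w|`,
`|T_M z| ≤ min(|z|, M)`, `|T_M z − z|² ≤ M^{2−p}|z|^p` for `2 < p ≤ 6`), and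
`∫|Ψ|^p ≤ (C_{GNS} ‖DΨ‖₂)^p ≤ (C_{GNS} (3N K)^{1/2})^p` for `p = 6N/(3N−2)` (Mathlib's
`eLpNorm_le_eLpNorm_fderiv_of_eq` on `(ℝ³)^N`, `eLpNorm_fderiv_le`), so `M = B` large makes
`∫|g − Ψ|² ≤ M^{2−p} (C_{GNS} (3NK)^{1/2})^p ≤ η`. [folklore] -/
theorem stub_truncHigh :
    ∀ (N : ℕ), 1 ≤ N → ∀ (K : ℝ≥0) (η : ℝ), 0 < η → ∃ B : ℝ≥0, ∀ (L : ℝ) (Ψ : TrialState N L),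
      ∫⁻ X, kineticDensity Ψ.ψ X ≤ K →
      ∃ g : Config N → ℂ, ContDiff ℝ 1 g ∧ (∀ X, X ∉ boxN N L → g X = 0) ∧
        (∀ (σ : Equiv.Perm (Fin N)) (X : Config N), g (X ∘ σ) = g X) ∧
        (∀ X, ‖g X‖ ≤ B) ∧ (∀ X, ‖g X‖ ≤ ‖Ψ.ψ X‖) ∧
        (∀ X, kineticDensity g X ≤ kineticDensity Ψ.ψ X) ∧
        ∫⁻ X, (‖g X - Ψ.ψ X‖₊ : ℝ≥0∞) ^ 2 ≤ ENNReal.ofReal η := by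
  intro N hN K η hη
  haveI : (volume : Measure (Config N)).IsAddHaarMeasure :=
    show Measure.IsAddHaarMeasure (Measure.pi fun _ : Fin N => (volume : Measure Space)) from
      Measure.pi.isAddHaarMeasure _
  -- the Sobolev exponent `p = 6N/(3N-2) ∈ (2, 6]`
  have hN' : (1 : ℝ) ≤ N := by exact_mod_cast hN
  have h3N : (0 : ℝ) < 3 * N - 2 := by linarith
  set p : ℝ := 6 * N / (3 * N - 2) with hp_def
  have hp2 : 2 < p := by
    rw [hp_def, lt_div_iff₀ h3N]; linarith
  have hp6 : p ≤ 6 := by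
    rw [hp_def, div_le_iff₀ h3N]; linarith
  have hp0 : 0 < p := by linarith
  set p' : ℝ≥0 := ⟨p, hp0.le⟩ with hp'_def
  have hp'coe : (p' : ℝ) = p := rfl
  have hp'0 : p' ≠ 0 := fun h => hp0.ne' (by rw [← hp'coe, h, NNReal.coe_zero])
  have hn : 0 < finrank ℝ (Config N) := by rw [finrank_config]; omega
  have hpinv : (p' : ℝ)⁻¹ = ((2 : ℝ≥0) : ℝ)⁻¹ - (finrank ℝ (Config N) : ℝ)⁻¹ := by
    rw [hp'coe, finrank_config, hp_def]
    push_cast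
    have hN0 : (N : ℝ) ≠ 0 := by positivity
    field_simp
    ring
  -- the GNS constant
  obtain ⟨C, hC⟩ : ∃ C : ℝ≥0, ∀ (L : ℝ) (Ψ : TrialState N L),
      eLpNorm Ψ.ψ p' volume ≤ (C : ℝ≥0∞) * eLpNorm (fderiv ℝ Ψ.ψ) 2 volume := by
    refine ⟨SNormLESNormFDerivOfEqConst ℂ (volume : Measure (Config N)) (2 : ℝ≥0), fun L Ψ => ?_⟩
    have h := eLpNorm_le_eLpNorm_fderiv_of_eq (volume : Measure (Config N)) Ψ.contDiff
      (hasCompactSupport_psi Ψ) (p := 2) one_le_two hn hpinv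
    simpa only [ENNReal.coe_ofNat] using h
  -- the uniform `L^p` bound `∫ |Ψ|^p ≤ S`
  set R : ℝ≥0∞ := (C : ℝ≥0∞) * ((3 * N : ℝ≥0∞) * K) ^ (1 / 2 : ℝ) with hR_def
  have hR : R ≠ ⊤ := ENNReal.mul_ne_top ENNReal.coe_ne_top
    (ENNReal.rpow_ne_top_of_nonneg (by norm_num)
      (ENNReal.mul_ne_top (ENNReal.mul_ne_top (by norm_num) (ENNReal.natCast_ne_top N))
        ENNReal.coe_ne_top))
  set S : ℝ≥0∞ := R ^ p with hS_def
  have hS : S ≠ ⊤ := ENNReal.rpow_ne_top_of_nonneg hp0.le hR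
  have hI : ∀ (L : ℝ) (Ψ : TrialState N L), ∫⁻ X, kineticDensity Ψ.ψ X ≤ K →
      ∫⁻ X, ‖Ψ.ψ X‖ₑ ^ p ≤ S := by
    intro L Ψ hK
    have hE : energy 0 Ψ ≤ K := by rw [energy_zero_eq]; exact hK
    have hfd := eLpNorm_fderiv_le 0 Ψ hE
    have hψ : eLpNorm Ψ.ψ p' volume ≤ R := (hC L Ψ).trans (by rw [hR_def]; gcongr)
    have h := eLpNorm_nnreal_pow_eq_lintegral (f := Ψ.ψ) (μ := volume) hp'0
    rw [hp'coe] at h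
    rw [← h]
    exact ENNReal.rpow_le_rpow hψ hp0.le
  -- choice of the truncation level `M`
  have hlim : Tendsto (fun M : ℝ => M ^ (2 - p) * S.toReal) atTop (𝓝 0) := by
    have h := (tendsto_rpow_neg_atTop (by linarith : 0 < p - 2)).mul_const S.toReal
    rw [zero_mul] at h
    exact h.congr fun M => by rw [neg_sub]
  obtain ⟨M, hM1, hMη⟩ :=
    ((eventually_ge_atTop (1 : ℝ)).and (hlim.eventually (eventually_le_nhds hη))).exists
  have hM : 0 < M := one_pos.trans_le hM1
  refine ⟨⟨M, hM.le⟩, fun L Ψ hK =>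
    ⟨fun X => (M / √(M ^ 2 + ‖Ψ.ψ X‖ ^ 2)) • Ψ.ψ X, ?_, ?_, ?_, ?_, ?_, ?_, ?_⟩⟩
  · exact (contDiff_trunc hM).comp Ψ.contDiff
  · intro X hX
    simp only [Ψ.eq_zero X hX, smul_zero]
  · intro σ X
    simp only [Ψ.symm σ X]
  · exact fun X => norm_trunc_le hM _
  · exact fun X => norm_trunc_le_norm hM _
  · exact fun X => kineticDensity_comp_le hM Ψ.contDiff X
  · calc ∫⁻ X, (‖(M / √(M ^ 2 + ‖Ψ.ψ X‖ ^ 2)) • Ψ.ψ X - Ψ.ψ X‖₊ : ℝ≥0∞) ^ 2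
        ≤ ∫⁻ X, ENNReal.ofReal (M ^ (2 - p)) * ‖Ψ.ψ X‖ₑ ^ p :=
          lintegral_mono fun X => enorm_trunc_sub_sq_le hM hp2.le hp6 _
      _ = ENNReal.ofReal (M ^ (2 - p)) * ∫⁻ X, ‖Ψ.ψ X‖ₑ ^ p :=
          lintegral_const_mul' _ _ ENNReal.ofReal_ne_top
      _ ≤ ENNReal.ofReal (M ^ (2 - p)) * S := by gcongr; exact hI L Ψ hK
      _ = ENNReal.ofReal (M ^ (2 - p) * S.toReal) := by
          rw [ENNReal.ofReal_mul (by positivity), ENNReal.ofReal_toReal hS]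
      _ ≤ ENNReal.ofReal η := ENNReal.ofReal_le_ofReal hMη

end Summit.AtomisticToContinuum.BoseEinsteinCondensation.Theorems.GroundStateRigidity
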